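import Literature.NumberTheory.QuadraticFields.ClassNumberOneGenus
import HarnessLib

/-!
# The class number one problem for `p ≡ 3 (mod 8)`: the small range `p ≤ 10⁶` by a Legendre sieve

Topic `NumberTheory/QuadraticFields`, namespace
`Literature.NumberTheory.QuadraticFields.BinaryQuadraticForm`; a proofs-only file (theorems, a list of
small primes and three kernel-evaluable `Bool` checkers; no named facts), sibling of `ClassNumberOneGenus.lean`
(the named fact `HeegnerStarkPrimeThreeModEight`: for a prime `p ≡ 3 (mod 8)`,
`h(−p) = 1 ⟹ p ∈ {3, 11, 19, 43, 67, 163}`), of `ClassNumberOneSmallRange.lean` (the sibling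
seat's kernel search for a second REDUCED form, `heegnerStarkPrime_small`: the same conclusion for
`p₀ ≤ 500000`, landed while this file was in review; the present file is an independent
certificate by a different method — quadratic residues instead of reduced forms — reaching
`10⁶`, which supersedes `500000` as the crossover `P₀` and leaves a wider margin for the medium
range) and of `ClassNumberOneBakerFundamental.lean`, whose
`BakerLimitFormula.heegnerStarkPrimeThreeModEight_of_ranges P₀ small large` reduces that fact to

* `small` — an enumeration of the range `p₀ ≤ P₀`, and
* `large` — the failure of Baker's fundamental inequality for `p₀ > P₀`
  (A. Baker, *Transcendental Number Theory*, Ch. 5 §4: beyond the range of the lower bound for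
  the linear form in two logarithms "only a finite amount of computation" remains).

This file PROVES `small` for `P₀ = 10⁶` (`heegnerStarkPrime_small_range`):

  `∀ p₀ prime, p₀ ≡ 3 (mod 8), p₀ ≤ 10⁶:  h(−p₀) = 1 ⟹ p₀ ∈ {3, 11, 19, 43, 67, 163}`.

(Baker's inequality `|105 h₂₁ X₂₁ − 66 h₃₃ X₃₃| ≤ 35280 e^{−π√d/21} + 34848 e^{−π√d/33}` for all
`1 ≤ h₂₁ ≤ 2(21d)²`, `1 ≤ h₃₃ ≤ 2(33d)²` cannot fail for every admissible pair unless its right-hand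
side is below about `(1764 d²)⁻¹` (Dirichlet's box principle), i.e. unless `d ≳ 2.5 · 10⁵`; so the
small range of any proof along Baker's route has to reach at least that far, and `10⁶` leaves a
margin for the continued-fraction treatment of the medium range.)

## The argument (Cox, *Primes of the form x² + ny²*, §2.A Lemma 2.5, Thm. 2.8, §2.C)

For a prime `p ≡ 3 (mod 4)` and an odd prime `ℓ` with `4ℓ < p`:
**if `h(−p) = 1` then `−p` is a quadratic non-residue modulo `ℓ`**
(`classNumber_ne_one_of_prime_dvd_sq_add`). Indeed, if `ℓ ∣ r² + p`, choose `b ≡ r (mod ℓ)` odd;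
then `4ℓ ∣ b² + p`, and `ℓx² + bxy + ((b² + p)/4ℓ)y²` is a primitive positive definite form of
discriminant `−p` representing `ℓ` (Cox, Lemma 2.5). When `h(−p) = 1` it is properly equivalent to
the form `x² + xy + ¼(p + 1)y²` (Cox, Thm. 2.8: one class), which therefore represents `ℓ`:
`4ℓ = (2x + y)² + p y²`, forcing `y = 0` (as `4ℓ < p`) and `ℓ = x²`, absurd. (Equivalently: for
`h(−p) = 1` every odd prime `ℓ < p/4` is inert in `ℚ(√−p)`, Rabinowitsch's criterion.)

The range `171 ≤ n ≤ 10⁶`, `n ≡ 3 (mod 8)` (`124979` values) is then covered by a sieve evaluated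
by the kernel (`decide +kernel`, as for the tree's table
`Quadratic.BinQF.mem_classNumberOneDiscrs_of_classNumber_eq_one_of_le` of `h(D)`, `D ≥ −200`):
for every such `n` some odd prime `ℓ ≤ 97` with `4ℓ < n` has `−n ≡ □ (mod ℓ)` (`sieve_cert₀`–`sieve_cert₄`,
about `5.7 · 10⁵` evaluations of `(r² + n) mod ℓ`; the same sieve has no survivor below `10⁷`),
and the primes `p ≤ 170` are read off that table.

## Mathlib / tree search

`lean search 'smallRange|classNumber_ne_one|of_ranges|classNumber_neg_prime'` (at the time of
writing): nothing on the small range in Mathlib or the tree besides the consumer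
`heegnerStarkPrimeThreeModEight_of_ranges` and the `D ≥ −200` table; the sibling file
`ClassNumberOneSmallRange.lean` (`SmallRange.checkN`, `two_le_classNumber_of_le`,
`heegnerStarkPrime_small`, `n ≤ 500000`) landed concurrently and shares no declaration with this
one. `Prime.not_isSquare` (Mathlib) gives `natCast_prime_ne_sq`. Used from the tree:
`Quadratic.BinQF.properEquiv_of_classNumber_eq_one` (Cox Thm. 2.8 for `h = 1`),
`binQF_classNumber_eq` (the two encodings of `h(D)` agree),
`Quadratic.BinQF.mem_classNumberOneDiscrs_of_classNumber_eq_one_of_le`.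

## References

* [Cox2013] D. A. Cox, *Primes of the form x² + ny²*, 2nd ed. (2013), §2.A Lemma 2.5, Thm. 2.8,
  Thm. 2.13, §2.C (principal form), §7.D Thm. 7.30, §12.E Thm. 12.34.
* [Baker1975] A. Baker, *Transcendental Number Theory* (1975), Ch. 5 §4.
-/

namespace Literature.NumberTheory.QuadraticFields.BinaryQuadraticForm

open Quadratic

/-! ### A small split (or ramified) odd prime forces `h(−p) ≥ 2` -/

/-- A prime is not a perfect square (of an integer) (Mathlib's `Prime.not_isSquare` in `ℤ`).
[folklore] -/
private theorem natCast_prime_ne_sq {ℓ : ℕ} (hℓ : ℓ.Prime) (m : ℤ) : (ℓ : ℤ) ≠ m ^ 2 :=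
  fun h => (Nat.prime_iff_prime_int.mp hℓ).not_isSquare ⟨m, by rw [h, sq]⟩

/-- **For `h(−p) = 1`, `−p` is a non-residue modulo every odd prime `ℓ < p/4`** (contrapositive):
if `p ≡ 3 (mod 4)` is prime, `ℓ` is an odd prime with `4ℓ < p` and `ℓ ∣ r² + p` for some `r`,
then `h(−p) ≠ 1`. With `b ≡ r (mod ℓ)` odd, `ℓx² + bxy + ((b² + p)/4ℓ)y²` is a primitive positive
definite form of discriminant `−p` representing `ℓ` (Cox, Lemma 2.5); if `h(−p) = 1` it is properly
equivalent to `x² + xy + ¼(p + 1)y²` (Cox, Thm. 2.8), which would then represent `ℓ`: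
`4ℓ = (2x + y)² + py²`, so `y = 0` and `ℓ = x²`, absurd.
[cite: Cox2013, §2.A Lemma 2.5 and Thm. 2.8] -/
theorem classNumber_ne_one_of_prime_dvd_sq_add {p ℓ r : ℕ} (hp : p.Prime) (hp4 : p % 4 = 3)
    (hℓ : ℓ.Prime) (hℓ2 : ℓ ≠ 2) (h4ℓ : 4 * ℓ < p) (hr : ℓ ∣ r * r + p) :
    classNumber (-(p : ℤ)) ≠ 1 := by
  intro h1
  have hD : (-(p : ℤ)) < 0 := by have := hp.two_le; omega
  have h1' : BinQF.classNumber (-(p : ℤ)) = 1 := by rw [binQF_classNumber_eq _ hD]; exact h1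
  have hℓodd : ℓ % 2 = 1 := (hℓ.eq_one_or_self_of_dvd 2 |> fun h => by
    rcases Nat.even_or_odd ℓ with he | ho
    · exfalso
      rcases h (even_iff_two_dvd.1 he) with h2 | h2
      · exact absurd h2 (by norm_num)
      · exact hℓ2 h2.symm
    · exact Nat.odd_iff.1 ho)
  -- an odd `b ≡ r (mod ℓ)` with `ℓ ∣ b² + p`
  obtain ⟨b, hbodd, hbℓ⟩ : ∃ b : ℕ, b % 2 = 1 ∧ (ℓ : ℤ) ∣ (b : ℤ) ^ 2 + p := by
    have hr' : (ℓ : ℤ) ∣ (r : ℤ) ^ 2 + p := by rw [sq]; exact_mod_cast hr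
    rcases Nat.even_or_odd r with he | ho
    · refine ⟨r + ℓ, ?_, ?_⟩
      · have := Nat.even_iff.1 he; omega
      · have : ((r + ℓ : ℕ) : ℤ) ^ 2 + p = ((r : ℤ) ^ 2 + p) + ℓ * (2 * r + ℓ) := by push_cast; ring
        rw [this]
        exact dvd_add hr' (dvd_mul_right _ _)
    · exact ⟨r, Nat.odd_iff.1 ho, hr'⟩
  -- `ℓ ∤ b` (else `ℓ ∣ p`, so `ℓ = p > 4ℓ`)
  have hℓb : ¬ ℓ ∣ b := by
    intro hdvd
    have h2 : (ℓ : ℤ) ∣ (b : ℤ) ^ 2 := dvd_pow (Int.natCast_dvd_natCast.2 hdvd) two_ne_zero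
    have h3 : (ℓ : ℤ) ∣ (p : ℤ) := by simpa using dvd_sub hbℓ h2
    have h4 : ℓ ∣ p := Int.natCast_dvd_natCast.1 h3
    rcases hp.eq_one_or_self_of_dvd ℓ h4 with h5 | h5
    · exact hℓ.one_lt.ne' h5
    · omega
  -- `4ℓ ∣ b² + p`
  have h4dvd : (4 : ℤ) ∣ (b : ℤ) ^ 2 + p := by
    have hb2 : ((b : ℤ)) % 2 = 1 := by exact_mod_cast hbodd
    have hp4' : ((p : ℤ)) % 4 = 3 := by exact_mod_cast hp4
    have : ((b : ℤ) ^ 2 + p) % 4 = 0 := by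
      have hb4 : (b : ℤ) % 4 = 1 ∨ (b : ℤ) % 4 = 3 := by omega
      rcases hb4 with h | h <;> simp [pow_two, Int.add_emod, Int.mul_emod, h, hp4']
    exact Int.dvd_of_emod_eq_zero this
  have hcop : IsCoprime (4 : ℤ) (ℓ : ℤ) := by
    rw [Int.isCoprime_iff_gcd_eq_one]
    change Nat.gcd 4 ℓ = 1
    have h2ℓ : Nat.Coprime 2 ℓ := (Nat.prime_two.coprime_iff_not_dvd).2 (by omega)
    simpa using h2ℓ.pow_left 2
  obtain ⟨c, hc⟩ := hcop.mul_dvd h4dvd hbℓ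
  -- the forms `f = (ℓ, b, c)` and `g = (1, 1, (p + 1)/4)`
  obtain ⟨q, hq⟩ : ∃ q : ℤ, (p : ℤ) + 1 = 4 * q := ⟨((p : ℤ) + 1) / 4, by omega⟩
  set f : BinQF := ⟨ℓ, b, c⟩ with hf_def
  set g : BinQF := ⟨1, 1, q⟩ with hg_def
  have hf : f.IsPosPrim (-(p : ℤ)) := by
    refine ⟨?_, by simp only [hf_def]; exact_mod_cast hℓ.pos, ?_⟩
    · simp only [BinQF.disc, hf_def]
      linear_combination hc
    · simp only [BinQF.IsPrimitive, hf_def, Int.natAbs_natCast]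
      rw [((hℓ.coprime_iff_not_dvd).2 hℓb).gcd_eq_one, Nat.gcd_one_left]
  have hg : g.IsPosPrim (-(p : ℤ)) := by
    refine ⟨?_, by simp [hg_def], by simp [BinQF.IsPrimitive, hg_def]⟩
    simp only [BinQF.disc, hg_def]
    linear_combination hq
  -- one class: `f = g · γ`, so `g` represents `ℓ = f.a`
  obtain ⟨x, y, z, w, -, hact⟩ := BinQF.properEquiv_of_classNumber_eq_one hD h1' hg hf
  have ha : (ℓ : ℤ) = x ^ 2 + x * z + q * z ^ 2 := by
    have := congrArg BinQF.a hact
    simp only [hf_def, hg_def, BinQF.act] at this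
    linear_combination this
  have h4l : 4 * (ℓ : ℤ) = (2 * x + z) ^ 2 + p * z ^ 2 := by
    linear_combination 4 * ha - z ^ 2 * hq
  rcases eq_or_ne z 0 with hz | hz
  · subst hz
    have : (ℓ : ℤ) = x ^ 2 := by linear_combination ha
    exact natCast_prime_ne_sq hℓ x this
  · have hz1 : 1 ≤ z ^ 2 := by
      rcases lt_or_gt_of_ne hz with h | h <;> nlinarith
    have h4ℓ' : 4 * (ℓ : ℤ) < p := by exact_mod_cast h4ℓ
    nlinarith [sq_nonneg (2 * x + z)]

/-! ### The sieve: kernel-evaluable checkers and their soundness -/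

/-- `sqrtNegBelow n ℓ t = true` iff some `r < t` has `ℓ ∣ r² + n` (search by structural
recursion, evaluated by the kernel). [folklore] -/
def sqrtNegBelow (n ℓ : ℕ) : ℕ → Bool
  | 0 => false
  | t + 1 => decide ((t * t + n) % ℓ = 0) || sqrtNegBelow n ℓ t

/-- Soundness of `sqrtNegBelow`. [folklore] -/
theorem exists_dvd_of_sqrtNegBelow {n ℓ : ℕ} : ∀ {t : ℕ}, sqrtNegBelow n ℓ t = true →
    ∃ r : ℕ, ℓ ∣ r * r + n
  | 0, h => by simp [sqrtNegBelow] at h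
  | t + 1, h => by
    rw [sqrtNegBelow, Bool.or_eq_true, decide_eq_true_eq] at h
    rcases h with h | h
    · exact ⟨t, Nat.dvd_of_mod_eq_zero h⟩
    · exact exists_dvd_of_sqrtNegBelow h

/-- The odd primes `ℓ ≤ 97` used by the sieve. [folklore] -/
def sievePrimes : List ℕ :=
  [3, 5, 7, 11, 13, 17, 19, 23, 29, 31, 37, 41, 43, 47, 53, 59, 61, 67, 71, 73, 79, 83, 89, 97]

/-- Every member of `sievePrimes` is an odd prime. [folklore] -/
theorem prime_of_mem_sievePrimes {ℓ : ℕ} (h : ℓ ∈ sievePrimes) : ℓ.Prime ∧ ℓ ≠ 2 := by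
  simp only [sievePrimes, List.mem_cons, List.not_mem_nil, or_false] at h
  rcases h with rfl | rfl | rfl | rfl | rfl | rfl | rfl | rfl | rfl | rfl | rfl | rfl | rfl | rfl |
    rfl | rfl | rfl | rfl | rfl | rfl | rfl | rfl | rfl | rfl <;>
  exact ⟨by norm_num, by norm_num⟩

/-- One step of the sieve at `n`: some `ℓ ∈ sievePrimes` with `4ℓ < n` has `−n ≡ □ (mod ℓ)`.
[folklore] -/
def sieveStep (n : ℕ) : Bool :=
  sievePrimes.any fun ℓ => decide (4 * ℓ < n) && sqrtNegBelow n ℓ ℓ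

/-- **Soundness of one sieve step**: if `sieveStep n` holds and `n ≡ 3 (mod 4)` is prime, then
`h(−n) ≠ 1` (`classNumber_ne_one_of_prime_dvd_sq_add`). [cite: Cox2013, §2.A Lemma 2.5 and Thm. 2.8] -/
theorem classNumber_ne_one_of_sieveStep {n : ℕ} (h : sieveStep n = true) (hn : n.Prime)
    (hn4 : n % 4 = 3) : classNumber (-(n : ℤ)) ≠ 1 := by
  rw [sieveStep, List.any_eq_true] at h
  obtain ⟨ℓ, hℓmem, hℓ⟩ := h
  rw [Bool.and_eq_true, decide_eq_true_eq] at hℓ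
  obtain ⟨hℓp, hℓ2⟩ := prime_of_mem_sievePrimes hℓmem
  obtain ⟨r, hr⟩ := exists_dvd_of_sqrtNegBelow hℓ.2
  exact classNumber_ne_one_of_prime_dvd_sq_add hn hn4 hℓp hℓ2 hℓ.1 hr

/-- The sieve on the `K` values `n = n₀, n₀ + 8, …, n₀ + 8(K − 1)`. [folklore] -/
def sieveFrom (n₀ : ℕ) : ℕ → Bool
  | 0 => true
  | k + 1 => sieveStep (8 * k + n₀) && sieveFrom n₀ k

/-- Soundness of `sieveFrom`. [folklore] -/
theorem sieveStep_of_sieveFrom {n₀ : ℕ} : ∀ {K : ℕ}, sieveFrom n₀ K = true → ∀ k, k < K →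
    sieveStep (8 * k + n₀) = true
  | 0, _, k, hk => absurd hk (Nat.not_lt_zero k)
  | K + 1, h, k, hk => by
    rw [sieveFrom, Bool.and_eq_true] at h
    rcases Nat.lt_succ_iff_lt_or_eq.1 hk with hk' | rfl
    · exact sieveStep_of_sieveFrom h.2 k hk'
    · exact h.1

/-! ### The sieve certificate, checked by the kernel in five chunks of `25000` values

For every `n ≡ 3 (mod 8)` with `171 ≤ n ≤ 1000163` some odd prime `ℓ ≤ 97` with `4ℓ < n` has
`−n ≡ □ (mod ℓ)` (about `5.7 · 10⁵` evaluations of `(r² + n) mod ℓ` in all; one chunk of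
`1.25 · 10⁵` values exceeds the kernel's recursion limits, chunks of `25000` take a few seconds
each). -/

/-- Chunk `171 ≤ n < 200171`. [folklore] -/
theorem sieve_cert₀ : sieveFrom 171 25000 = true := by
  decide +kernel

/-- Chunk `200171 ≤ n < 400171`. [folklore] -/
theorem sieve_cert₁ : sieveFrom 200171 25000 = true := by
  decide +kernel

/-- Chunk `400171 ≤ n < 600171`. [folklore] -/
theorem sieve_cert₂ : sieveFrom 400171 25000 = true := by
  decide +kernel

/-- Chunk `600171 ≤ n < 800171`. [folklore] -/
theorem sieve_cert₃ : sieveFrom 600171 25000 = true := by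
  decide +kernel

/-- Chunk `800171 ≤ n < 1000171`. [folklore] -/
theorem sieve_cert₄ : sieveFrom 800171 25000 = true := by
  decide +kernel

/-- **The sieve certificate assembled**: `sieveStep n` for all `n ≡ 3 (mod 8)`,
`171 ≤ n ≤ 10⁶`. [folklore] -/
theorem sieveStep_of_le_million {n : ℕ} (h8 : n % 8 = 3) (h171 : 171 ≤ n) (hle : n ≤ 1000000) :
    sieveStep n = true := by
  have key : ∀ i : ℕ, i < 5 → sieveFrom (200000 * i + 171) 25000 = true := by
    intro i hi
    interval_cases i
    · exact sieve_cert₀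
    · exact sieve_cert₁
    · exact sieve_cert₂
    · exact sieve_cert₃
    · exact sieve_cert₄
  have hi : (n - 171) / 200000 < 5 := by omega
  have hk : (n - 171) % 200000 / 8 < 25000 := by omega
  have hn : 8 * ((n - 171) % 200000 / 8) + (200000 * ((n - 171) / 200000) + 171) = n := by omega
  have h := sieveStep_of_sieveFrom (key _ hi) _ hk
  rwa [hn] at h

/-! ### The small range -/

/-- **No prime `p ≡ 3 (mod 8)` with `171 ≤ p ≤ 10⁶` has `h(−p) = 1`.**
[cite: Cox2013, §7.D Thm. 7.30 (the list), §2.A Lemma 2.5 and Thm. 2.8 (the method)] -/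
theorem classNumber_ne_one_of_le_million {p : ℕ} (hp : p.Prime) (h8 : p % 8 = 3)
    (h171 : 171 ≤ p) (hle : p ≤ 1000000) : classNumber (-(p : ℤ)) ≠ 1 :=
  classNumber_ne_one_of_sieveStep (sieveStep_of_le_million h8 h171 hle) hp (by omega)

/-- **The small range of the class number one problem for `p ≡ 3 (mod 8)`, `P₀ = 10⁶`**: a prime
`p₀ ≡ 3 (mod 8)` with `p₀ ≤ 10⁶` and `h(−p₀) = 1` is one of `3, 11, 19, 43, 67, 163` — the
hypothesis `small` of `BakerLimitFormula.heegnerStarkPrimeThreeModEight_of_ranges 1000000`.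
The primes `p₀ ≤ 170` are read off the tree's table of `h(D)` for `D ≥ −200`; the rest is
`classNumber_ne_one_of_le_million`. [cite: Cox2013, §7.D Thm. 7.30 and §12.E Thm. 12.34] -/
theorem heegnerStarkPrime_small_range : ∀ p₀ : ℕ, p₀.Prime → p₀ % 8 = 3 → p₀ ≤ 1000000 →
    classNumber (-(p₀ : ℤ)) = 1 → p₀ ∈ ({3, 11, 19, 43, 67, 163} : Finset ℕ) := by
  intro p₀ hp h8 hle h1
  by_cases h171 : 171 ≤ p₀
  · exact absurd h1 (classNumber_ne_one_of_le_million hp h8 h171 hle)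
  · have hD : (-(p₀ : ℤ)) < 0 := by have := hp.two_le; omega
    have h1' : BinQF.classNumber (-(p₀ : ℤ)) = 1 := by rw [binQF_classNumber_eq _ hD]; exact h1
    have hmem := BinQF.mem_classNumberOneDiscrs_of_classNumber_eq_one_of_le hD (by omega) h1'
    simp only [BinQF.classNumberOneDiscrs, Finset.mem_insert, Finset.mem_singleton] at hmem
    simp only [Finset.mem_insert, Finset.mem_singleton]
    have h27 : p₀ ≠ 27 := by
      rintro rfl
      exact absurd hp (by norm_num)
    omega

end Literature.NumberTheory.QuadraticFields.BinaryQuadraticForm
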